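import Literature.Computability.FineGrained.NSETHNonReducibilityAPSPProofs
import Literature.Computability.FineGrained.NSETHMachineModel
import HarnessLib

/-!
# NSETH and the non-reducibility of CNF-SAT to APSP: the discharge

This file closes the named fact `Literature.Computability.FineGrained.not_fgReducible_cnfSATWithSize_apsp_of_nseth`
(**fine-grained.S20** for APSP, `SETHHardness.lean`; Carmosino–Gao–Impagliazzo–Mihajlin–Paturi–Schneider,
*Nondeterministic extensions of the Strong Exponential Time Hypothesis and consequences for
non-reducibility*, ITCS 2016, §1 and §5, Thm. 2–3): assuming NSETH, for every `c ≥ 2` and every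
weight exponent `c'` there is no deterministic fine-grained reduction from `CNFSATWithSize c`
(budget `2ⁿ`) to `APSP c'` at its conjectured exponent `n³`.

The proof is the composition of two results already in the tree:

* `not_fgReducible_cnfSATWithSize_apsp_of_nseth_of_threeSumBridge`
  (`NSETHNonReducibilityAPSPProofs.lean`): the whole CGIMPS argument carried out on the word RAM —
  the reduction run as an oracle program against the canonical APSP oracle
  (`NSETHNonReducibilityAPSP.lean`, §3 Lemma 1 of the source: "run the reduction and simulate the
  oracle calls"), the in-RAM elimination of the APSP oracle by the simulating machine with wipes
  (`WordRAM.Inline.SIM'`, `WordRAMInline4.lean`) inlining the verified cubic APSP program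
  (`APSP_inTimeO_cube_holds`), sparsification and `k`-TAUT from `k`-SAT (`NSETHNonReducibility.lean`,
  `NSETHSparseTransfer.lean`) — leaving exactly one hypothesis, the change of machine model
  `sparseKSATInExpTime_of_cnfSATInThreeSumOracleRAMTime`;
* `sparseKSATInExpTime_of_cnfSATInThreeSumOracleRAMTime_holds` (`NSETHMachineModel.lean`): that
  change of machine model (a `2^{ρ n}`-step word-RAM program with `O(log n)`-bit words is simulated by
  a multi-stack Turing machine in time `2^{(ρ+η) n} · poly`, Cook–Reckhow 1973, §2), discharged.

Remark on the exponent. The source proves the sharper statement that no deterministic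
fine-grained reduction exists even to `(APSP, n^{(3+ω)/2+γ})` for any `γ > 0` (Thm. 3, via the
`(N ∩ coN)TIME[Õ(n^{(3+ω)/2})]` algorithm for zero-weight triangle of §5.6); the named fact of
`SETHHardness.lean` asserts only the consequence at the conjectured exponent `n³` (OUTLINE R8), and in
the word-RAM model of `FGReducible` (words of `O(log n)` bits, hence polynomial memory) that
consequence follows from the deterministic cubic APSP algorithm alone, which is the route formalised
here.

## References

* M. L. Carmosino, J. Gao, R. Impagliazzo, I. Mihajlin, R. Paturi, S. Schneider, *Nondeterministic
  extensions of the Strong Exponential Time Hypothesis and consequences for non-reducibility*,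
  ITCS 2016, doi:10.1145/2840728.2840746, §1, §3 Lemma 1, §5 Thm. 2–3. [`CarmosinoEtAlITCS2016`]
* S. A. Cook, R. A. Reckhow, *Time bounded random access machines*, JCSS 7 (1973) 354–375, §2.
  [`CookReckhow1973`]
* V. Vassilevska Williams, *On some fine-grained questions in algorithms and complexity*,
  Proc. ICM 2018, §2, Def. 2.1. [`VassilevskaWilliamsICM2018`]
-/

namespace Literature.Computability.FineGrained

/-- **fine-grained.S20 for APSP, discharged** (Carmosino–Gao–Impagliazzo–Mihajlin–Paturi–Schneider,
ITCS 2016, §1 / §5 Thm. 2–3): assuming NSETH, for every `c ≥ 2` and every `c'` there is no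
deterministic fine-grained reduction from `CNFSATWithSize c` with budget `2ⁿ` to `APSP c'` with budget
`n³`. Proof: the word-RAM form of the CGIMPS argument
(`not_fgReducible_cnfSATWithSize_apsp_of_nseth_of_threeSumBridge`) applied to the discharged change of
machine model `sparseKSATInExpTime_of_cnfSATInThreeSumOracleRAMTime_holds`.
[cite: CarmosinoEtAlITCS2016, §5 Thm. 2–3 (APSP)] -/
theorem not_fgReducible_cnfSATWithSize_apsp_of_nseth_holds :
    not_fgReducible_cnfSATWithSize_apsp_of_nseth :=
  not_fgReducible_cnfSATWithSize_apsp_of_nseth_of_threeSumBridge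
    sparseKSATInExpTime_of_cnfSATInThreeSumOracleRAMTime_holds

end Literature.Computability.FineGrained
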